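import Mathlib
import HarnessLib
import Literature.Analysis.FluidPDE.TypeIAncientMild
import Literature.Analysis.FluidPDE.KatoLocalBoundedPicard

/-!
# Route `QuarterLogPincer`, crux `TypeIQuantSubcubicExp` (stmt-NavierStokesRegularity-24077), line `truncation_edge` — towards stub T1
# `stub_farFieldTruncation`: `L^∞` STABILITY OF OSEEN-MILD FIELDS UNDER A TYPE-I DRIFT (polynomial amplification)

The line `Cruxes/TypeIQuantSubcubicExp/Lines/truncation_edge.lean` (ns-idea-7 g8; idea-crit-4 PASS) has one open stub, T1
`StubFarFieldTruncation` (`Theorems/QuarterLogPincerTruncationEdgeDefs.lean`): a finite-energy Tao-frame truncation `u` of an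
enveloped Type-I ancient mild field `v` on `[0, 1−ε]` with (i) a Type-I bound, (ii) a log-size `L³` bound, (iii) `δ`-closeness to `v`
at the final time, at a radius POLYNOMIAL in `1/ε`.  Its card asks, as «the prover's first computation», for the block estimate of
the LINEAR Oseen system around the Type-I drift: per dyadic time block a factor `exp(C(M+1)²)`, `log₂(1/ε)` blocks, hence an
amplification `ε^{−κ(M)}` — polynomial, not `exp(c/ε)`.  This file is that computation as a kernel theorem, in the pressure-free
Oseen gauge and for the full nonlinear difference (helper `--supports stmt-NavierStokesRegularity-24077`; pub-ns-dss typer g35).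
All statements are proved; tools: `exists_norm_oseenDuhamel_le_mul`, `oseenDuhamel_self_sub_self` (`KatoLocalBoundedPicard.lean`;
KNSS 2009 §4 p. 8, Lemarié-Rieusset 2016 Thm. 5.1) and the maximum principle `UnboundedOperators.norm_heatExtension_le`.

* `exists_oseenMild_sub_step` — ONE SHORT STEP: `u`, `v` jointly continuous on `[s,T] × ℝ³`, Oseen-mild from `s`, both bounded by
  `U`, `8CU√(T−s) ≤ 1` ⇒ `sup_{[s,T]}‖u − v‖ ≤ 2 sup‖u(s) − v(s)‖` (the a-priori bound `2U` starts the iteration `K ↦ η + K/2`).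
* `exists_oseenMild_sub_le_two_pow` — BOUNDED DRIFT on `[a,b]`: amplification `2^N`, `N = ⌈64C²U²(b−a)⌉` (chain of short steps;
  mildness between EVERY pair of times is what allows the restarts).
* `exists_oseenMild_sub_le_of_typeI` — TYPE-I DRIFT `M/√(T₀−t)` on `[a,T]`, `T < T₀`:
  `‖u(t) − v(t)‖_∞ ≤ ‖u(a) − v(a)‖_∞ · (2(T₀−a)/(T₀−t))^m`, `m = ⌈64C²M²⌉` (scale invariance: on the dyadic block
  `[T₀−(T₀−a)2^{−j}, T₀−(T₀−a)2^{−j−1}]` one has `64C²U_j²·|block| = 64C²M²`, so every block costs the same factor `2^m`).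
* `exists_sub_typeIAncientMild_le` — the same against a class member `IsTypeIAncientMild M v` on `[s₀,T] ⊂ (−∞,0)`.

READING for T1 (see the sizing note `pub-ns-dss/typer/T1-SIZING-typer-g35.md`, evidence #58 on 24077): with `u` the truncation of
`v` at radius `R` issued at `s₀ = −1`, the ENVELOPE `|v(−1,x)| ≤ A/(|x|+1)` makes `η ≲ A/R`, so clause (iii) holds down to `t = −ε` once
`R ≳ (A/δ)(2/ε)^{κ(M)}` — a polynomial radius, with no cut-off commutator and no pressure.  NOT addressed here: the existence of the
truncation in the Tao frame, and clause (ii) (the log-size `L³` bound), which is the real residual of T1 (it needs a two-region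
estimate).  HONEST FRAME: a stability lemma about HYPOTHETICAL objects; T1, 24077, 22144 and NS regularity are OPEN and untouched.
-/

noncomputable section

set_option linter.dupNamespace false

namespace Summit.NavierStokesRegularity.NavierStokesRegularity.Theorems.QuarterLogPincerTruncationEdge

open MeasureTheory Set Function Filter Real Metric
open scoped ENNReal NNReal Topology
open Literature.Analysis Literature.Analysis.FluidPDE

/-- Slices of a field jointly continuous on a closed slab are continuous. [folklore] -/
theorem continuous_slice_of_continuousOn_slab
    {u : ℝ → EuclideanSpace ℝ (Fin 3) → EuclideanSpace ℝ (Fin 3)} {a b s : ℝ}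
    (hu : ContinuousOn (uncurry u) (Icc a b ×ˢ univ)) (hs : s ∈ Icc a b) :
    Continuous (u s) := by
  have h : Continuous fun y : EuclideanSpace ℝ (Fin 3) => uncurry u (s, y) :=
    hu.comp_continuous (continuous_const.prodMk continuous_id) fun y => ⟨hs, mem_univ y⟩
  exact h

/-- Joint measurability on an open sub-slab of a field jointly continuous on a closed slab. [folklore] -/
theorem aestronglyMeasurable_of_continuousOn_slab
    {u : ℝ → EuclideanSpace ℝ (Fin 3) → EuclideanSpace ℝ (Fin 3)} {a b s T : ℝ}
    (hu : ContinuousOn (uncurry u) (Icc a b ×ˢ univ)) (hs : a ≤ s) (hT : T ≤ b) :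
    AEStronglyMeasurable (uncurry u)
      ((volume : Measure (ℝ × EuclideanSpace ℝ (Fin 3))).restrict (Ioo s T ×ˢ univ)) :=
  (hu.mono (prod_mono (fun _ hτ => ⟨hs.trans hτ.1.le, hτ.2.le.trans hT⟩) subset_rfl)).aestronglyMeasurable
    (measurableSet_Ioo.prod MeasurableSet.univ)

/-! ## One short step -/

/-- **One short step of the `L^∞` stability estimate in the Oseen gauge.**  There is a universal `C > 0` (the constant of the
bilinear sup bound `‖B¹_s(f,g)(t)‖ ≤ C‖f‖_∞‖g‖_∞·2√(t−s)`, `exists_norm_oseenDuhamel_le_mul`) such that: if `u`, `v` are jointly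
continuous on `[s,T] × ℝ³`, both Oseen-mild from time `s` on `(s,T]`, both bounded by `U > 0` there, `‖u(s,·) − v(s,·)‖ ≤ η`, and the
step is short, `8·C·U·√(T−s) ≤ 1`, then `‖u(t,x) − v(t,x)‖ ≤ 2η` on `[s,T]`.  (Write `w = u − v`; `w(t) = e^{(t−s)Δ}w(s) −
B_s(w,u)(t) − B_s(v,w)(t)` by bilinearity, so `sup‖w‖ ≤ η + 4CU√(T−s)·sup‖w‖ ≤ η + ½ sup‖w‖`; the a-priori finiteness
`sup‖w‖ ≤ 2U` starts the iteration `K ↦ η + K/2`.) [folklore; KNSS 2009 §4 p. 8 (the bound for `B`)] -/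
theorem exists_oseenMild_sub_step :
    ∃ C : ℝ, 0 < C ∧ ∀ {u v : ℝ → EuclideanSpace ℝ (Fin 3) → EuclideanSpace ℝ (Fin 3)} {s T U η : ℝ},
      s < T → ContinuousOn (uncurry u) (Icc s T ×ˢ univ) → ContinuousOn (uncurry v) (Icc s T ×ˢ univ) →
      (∀ t ∈ Ioc s T, ∀ x, u t x = heatFlow (u s) (t - s) x - oseenDuhamel 1 s u u t x) →
      (∀ t ∈ Ioc s T, ∀ x, v t x = heatFlow (v s) (t - s) x - oseenDuhamel 1 s v v t x) →
      0 < U → (∀ τ ∈ Icc s T, ∀ y, ‖u τ y‖ ≤ U) → (∀ τ ∈ Icc s T, ∀ y, ‖v τ y‖ ≤ U) →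
      (∀ y, ‖u s y - v s y‖ ≤ η) → 8 * C * U * Real.sqrt (T - s) ≤ 1 →
      ∀ t ∈ Icc s T, ∀ x, ‖u t x - v t x‖ ≤ 2 * η := by
  obtain ⟨C, hC, hB⟩ := exists_norm_oseenDuhamel_le_mul (E := EuclideanSpace ℝ (Fin 3))
  refine ⟨C, hC, ?_⟩
  intro u v s T U η hsT hcu hcv hmu hmv hU huU hvU hη hshort
  have hη0 : 0 ≤ η := (norm_nonneg _).trans (hη 0)
  -- measurability on the open slab `(s,T) × ℝ³`
  have hmu' := aestronglyMeasurable_of_continuousOn_slab hcu le_rfl le_rfl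
  have hmv' := aestronglyMeasurable_of_continuousOn_slab hcv le_rfl le_rfl
  have huU' : ∀ τ ∈ Ioo s T, ∀ y, ‖u τ y‖ ≤ U := fun τ hτ y => huU τ ⟨hτ.1.le, hτ.2.le⟩ y
  have hvU' : ∀ τ ∈ Ioo s T, ∀ y, ‖v τ y‖ ≤ U := fun τ hτ y => hvU τ ⟨hτ.1.le, hτ.2.le⟩ y
  -- the improvement step: a uniform bound `K` on `w` over `[s,T]` improves to `η + K/2`
  have himp : ∀ K : ℝ, 0 ≤ K → (∀ τ ∈ Icc s T, ∀ y, ‖u τ y - v τ y‖ ≤ K) →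
      ∀ t ∈ Icc s T, ∀ x, ‖u t x - v t x‖ ≤ η + K / 2 := by
    intro K hK hwK t ht x
    rcases eq_or_lt_of_le ht.1 with h | h
    · rw [← h]
      exact (hη x).trans (by linarith)
    have htT : t ≤ T := ht.2
    have hts : 0 < t - s := sub_pos.2 h
    -- the heat term
    have hheat : ‖heatFlow (u s) (t - s) x - heatFlow (v s) (t - s) x‖ ≤ η := by
      rw [heatFlow_of_pos _ hts, heatFlow_of_pos _ hts,
        ← UnboundedOperators.heatExtension_sub_of_bound
          (continuous_slice_of_continuousOn_slab hcu (left_mem_Icc.2 hsT.le))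
          (continuous_slice_of_continuousOn_slab hcv (left_mem_Icc.2 hsT.le))
          (fun z => huU s (left_mem_Icc.2 hsT.le) z) (fun z => hvU s (left_mem_Icc.2 hsT.le) z) hts x]
      exact UnboundedOperators.norm_heatExtension_le hη hts x
    -- the Duhamel terms
    have hwK' : ∀ τ ∈ Ioo s t, ∀ y, ‖u τ y - v τ y‖ ≤ K := fun τ hτ y =>
      hwK τ ⟨hτ.1.le, hτ.2.le.trans htT⟩ y
    have huUt : ∀ τ ∈ Ioo s t, ∀ y, ‖u τ y‖ ≤ U := fun τ hτ y => huU τ ⟨hτ.1.le, hτ.2.le.trans htT⟩ y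
    have hvUt : ∀ τ ∈ Ioo s t, ∀ y, ‖v τ y‖ ≤ U := fun τ hτ y => hvU τ ⟨hτ.1.le, hτ.2.le.trans htT⟩ y
    have hsplit := oseenDuhamel_self_sub_self (ν := (1:ℝ)) one_pos hmu' hmv' huU' hvU' h htT x
    have h1 : ‖oseenDuhamel 1 s (fun τ y => u τ y - v τ y) u t x‖ ≤ C * K * U * (2 * Real.sqrt (t - s)) := by
      have := hB one_pos h hK hU.le hwK' huUt x
      simpa only [Real.one_rpow, mul_one] using this
    have h2 : ‖oseenDuhamel 1 s v (fun τ y => u τ y - v τ y) t x‖ ≤ C * U * K * (2 * Real.sqrt (t - s)) := by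
      have := hB one_pos h hU.le hK hvUt hwK' x
      simpa only [Real.one_rpow, mul_one] using this
    have hsqrt : Real.sqrt (t - s) ≤ Real.sqrt (T - s) := Real.sqrt_le_sqrt (by linarith)
    have hD : ‖oseenDuhamel 1 s u u t x - oseenDuhamel 1 s v v t x‖ ≤ K / 2 := by
      rw [hsplit]
      refine (norm_add_le _ _).trans ?_
      have h3 : C * K * U * (2 * Real.sqrt (t - s)) + C * U * K * (2 * Real.sqrt (t - s))
          = (8 * C * U * Real.sqrt (t - s)) * K / 2 := by ring
      refine (add_le_add h1 h2).trans ?_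
      rw [h3]
      have h4 : 8 * C * U * Real.sqrt (t - s) ≤ 1 :=
        (mul_le_mul_of_nonneg_left hsqrt (by positivity)).trans hshort
      have h5 : (8 * C * U * Real.sqrt (t - s)) * K ≤ 1 * K := mul_le_mul_of_nonneg_right h4 hK
      linarith
    rw [hmu t ⟨h, htT⟩ x, hmv t ⟨h, htT⟩ x]
    have e : heatFlow (u s) (t - s) x - oseenDuhamel 1 s u u t x -
        (heatFlow (v s) (t - s) x - oseenDuhamel 1 s v v t x) =
        (heatFlow (u s) (t - s) x - heatFlow (v s) (t - s) x) -
          (oseenDuhamel 1 s u u t x - oseenDuhamel 1 s v v t x) := by abel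
    rw [e]
    exact (norm_sub_le _ _).trans (add_le_add hheat hD)
  -- iterate from the a-priori bound `2U`
  have hiter : ∀ n : ℕ, ∀ τ ∈ Icc s T, ∀ y, ‖u τ y - v τ y‖ ≤ 2 * η + 2 * U * (1 / 2 : ℝ) ^ n := by
    intro n
    induction n with
    | zero =>
      intro τ hτ y
      have : ‖u τ y - v τ y‖ ≤ 2 * U :=
        (norm_sub_le _ _).trans (by linarith [huU τ hτ y, hvU τ hτ y])
      simp only [pow_zero, mul_one]
      linarith
    | succ n ih =>
      intro τ hτ y
      have hK : 0 ≤ 2 * η + 2 * U * (1 / 2 : ℝ) ^ n := by positivity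
      have := himp _ hK ih τ hτ y
      have e : η + (2 * η + 2 * U * (1 / 2 : ℝ) ^ n) / 2 = 2 * η + 2 * U * (1 / 2 : ℝ) ^ (n + 1) := by
        rw [pow_succ]; ring
      linarith
  intro t ht x
  have hlim : Tendsto (fun n : ℕ => 2 * η + 2 * U * (1 / 2 : ℝ) ^ n) atTop (𝓝 (2 * η)) := by
    have : Tendsto (fun n : ℕ => (1 / 2 : ℝ) ^ n) atTop (𝓝 0) :=
      tendsto_pow_atTop_nhds_zero_of_lt_one (by norm_num) (by norm_num)
    simpa using (this.const_mul (2 * U)).const_add (2 * η)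
  exact ge_of_tendsto' hlim fun n => hiter n t ht x

/-! ## Bounded drift: a chain of short steps -/

/-- **`L^∞` stability of Oseen-mild fields under a bounded drift: amplification `2^N`, `N = ⌈64C²U²(b−a)⌉`.**
With the universal constant `C` of `exists_oseenMild_sub_step`: two fields jointly continuous on `[a,b] × ℝ³`, Oseen-mild between
every pair of times `a ≤ s < t ≤ b`, both bounded by `U > 0`, with `‖u(a,·) − v(a,·)‖ ≤ η`, satisfy
`‖u(t,x) − v(t,x)‖ ≤ 2^{⌈64 C² U² (b−a)⌉} η` on `[a,b]` (chain `⌈(b−a)/h₀⌉` short steps of length `h₀ = (64C²U²)⁻¹`, each doubling).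
[folklore; the block count of the line card's pen lemma, `Cruxes/TypeIQuantSubcubicExp/Lines/truncation-edge.md`] -/
theorem exists_oseenMild_sub_le_two_pow :
    ∃ C : ℝ, 0 < C ∧ ∀ {u v : ℝ → EuclideanSpace ℝ (Fin 3) → EuclideanSpace ℝ (Fin 3)} {a b U η : ℝ},
      a ≤ b → ContinuousOn (uncurry u) (Icc a b ×ˢ univ) → ContinuousOn (uncurry v) (Icc a b ×ˢ univ) →
      (∀ s t : ℝ, a ≤ s → s < t → t ≤ b → ∀ x, u t x = heatFlow (u s) (t - s) x - oseenDuhamel 1 s u u t x) →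
      (∀ s t : ℝ, a ≤ s → s < t → t ≤ b → ∀ x, v t x = heatFlow (v s) (t - s) x - oseenDuhamel 1 s v v t x) →
      0 < U → (∀ τ ∈ Icc a b, ∀ y, ‖u τ y‖ ≤ U) → (∀ τ ∈ Icc a b, ∀ y, ‖v τ y‖ ≤ U) →
      (∀ y, ‖u a y - v a y‖ ≤ η) →
      ∀ t ∈ Icc a b, ∀ x, ‖u t x - v t x‖ ≤ 2 ^ ⌈64 * C ^ 2 * U ^ 2 * (b - a)⌉₊ * η := by
  obtain ⟨C, hC, hstep⟩ := exists_oseenMild_sub_step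
  refine ⟨C, hC, ?_⟩
  intro u v a b U η hab hcu hcv hmu hmv hU huU hvU hη
  have hη0 : 0 ≤ η := (norm_nonneg _).trans (hη 0)
  -- the step length
  set h₀ : ℝ := 1 / (64 * C ^ 2 * U ^ 2) with hh₀
  have hh₀pos : 0 < h₀ := by positivity
  have hsqrt_h₀ : Real.sqrt h₀ = 1 / (8 * C * U) := by
    rw [show h₀ = (1 / (8 * C * U)) ^ 2 by rw [hh₀]; field_simp; ring]
    exact Real.sqrt_sq (by positivity)
  -- induction over the steps
  have hind : ∀ k : ℕ, ∀ t ∈ Icc a b, t ≤ a + k * h₀ → ∀ x, ‖u t x - v t x‖ ≤ 2 ^ k * η := by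
    intro k
    induction k with
    | zero =>
      intro t ht htk x
      have hta : t = a := le_antisymm (by simpa using htk) ht.1
      rw [hta, pow_zero, one_mul]
      exact hη x
    | succ k ih =>
      intro t ht htk x
      by_cases hle : t ≤ a + k * h₀
      · refine (ih t ht hle x).trans ?_
        rw [pow_succ]
        nlinarith [pow_pos (show (0:ℝ) < 2 by norm_num) k]
      push Not at hle
      set s : ℝ := a + k * h₀ with hs
      have has : a ≤ s := by rw [hs]; nlinarith [hh₀pos.le, (k.cast_nonneg : (0:ℝ) ≤ k)]
      have hst : s < t := hle
      have hsb : s ≤ b := hst.le.trans ht.2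
      set T : ℝ := min b (s + h₀) with hT
      have hsT : s < T := lt_min (lt_of_lt_of_le hst ht.2) (by linarith)
      have hTb : T ≤ b := min_le_left _ _
      have htT : t ≤ T := le_min ht.2 (by
        have : ((k + 1 : ℕ) : ℝ) * h₀ = k * h₀ + h₀ := by push_cast; ring
        linarith)
      have hsub : Icc s T ×ˢ (univ : Set (EuclideanSpace ℝ (Fin 3))) ⊆ Icc a b ×ˢ univ :=
        prod_mono (Icc_subset_Icc has hTb) subset_rfl
      have hηs : ∀ y, ‖u s y - v s y‖ ≤ 2 ^ k * η := fun y => ih s ⟨has, hsb⟩ le_rfl y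
      have hshort : 8 * C * U * Real.sqrt (T - s) ≤ 1 := by
        have h1 : Real.sqrt (T - s) ≤ Real.sqrt h₀ := Real.sqrt_le_sqrt (by linarith [min_le_right b (s + h₀)])
        calc 8 * C * U * Real.sqrt (T - s) ≤ 8 * C * U * Real.sqrt h₀ :=
              mul_le_mul_of_nonneg_left h1 (by positivity)
          _ = 1 := by rw [hsqrt_h₀]; field_simp
      have := hstep hsT (hcu.mono hsub) (hcv.mono hsub)
        (fun t' ht' x' => hmu s t' has ht'.1 (ht'.2.trans hTb) x')
        (fun t' ht' x' => hmv s t' has ht'.1 (ht'.2.trans hTb) x')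
        hU (fun τ hτ y => huU τ ⟨has.trans hτ.1, hτ.2.trans hTb⟩ y)
        (fun τ hτ y => hvU τ ⟨has.trans hτ.1, hτ.2.trans hTb⟩ y) hηs hshort t ⟨hst.le, htT⟩ x
      rw [pow_succ]
      linarith
  -- cover `[a,b]` by `N = ⌈(b−a)/h₀⌉` steps
  intro t ht x
  refine hind _ t ht ?_ x
  have hN : (b - a) / h₀ ≤ (⌈64 * C ^ 2 * U ^ 2 * (b - a)⌉₊ : ℝ) := by
    have : (b - a) / h₀ = 64 * C ^ 2 * U ^ 2 * (b - a) := by rw [hh₀]; field_simp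
    rw [this]
    exact Nat.le_ceil _
  have : b - a ≤ (⌈64 * C ^ 2 * U ^ 2 * (b - a)⌉₊ : ℝ) * h₀ := by
    rw [div_le_iff₀ hh₀pos] at hN
    exact hN
  linarith [ht.2]

/-! ## Type-I drift: dyadic blocks, polynomial amplification -/

/-- **`L^∞` STABILITY OF OSEEN-MILD FIELDS UNDER A TYPE-I DRIFT — POLYNOMIAL AMPLIFICATION.**  With the universal constant `C` of
`exists_oseenMild_sub_step` and `m := ⌈64 C² M²⌉`: if `u`, `v` are jointly continuous on `[a,T] × ℝ³`, Oseen-mild between every pair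
of times `a ≤ s < t ≤ T`, and both obey the Type-I bound `M/√(T₀ − t)` there (`T < T₀`, `M > 0`), then
`‖u(t,x) − v(t,x)‖ ≤ sup‖u(a,·) − v(a,·)‖ · (2(T₀−a)/(T₀−t))^m` on `[a,T]`: the amplification is POLYNOMIAL in `(T₀−a)/(T₀−t)` with
an exponent depending on `M` only (scale invariance: on the dyadic block `[T₀ − (T₀−a)2^{−j}, T₀ − (T₀−a)2^{−j−1}]` the drift is
`≤ M 2^{(j+1)/2}(T₀−a)^{−1/2}` and `64C²U²·|block| = 64C²M²`, so every block costs the same factor `2^m`).  This is the kernel form of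
the «first computation» asked of a T1 prover by the line card `truncation-edge.md` (pen lemma: per-block factor `exp(C(M+1)²)`,
`log₂(1/ε)` blocks, hence `ε^{−κ(M)}` — polynomial, not `exp(c/ε)`). [folklore; KNSS 2009 §4 p. 8] -/
theorem exists_oseenMild_sub_le_of_typeI :
    ∃ C : ℝ, 0 < C ∧ ∀ {u v : ℝ → EuclideanSpace ℝ (Fin 3) → EuclideanSpace ℝ (Fin 3)} {a T T₀ M η : ℝ},
      a ≤ T → T < T₀ → ContinuousOn (uncurry u) (Icc a T ×ˢ univ) → ContinuousOn (uncurry v) (Icc a T ×ˢ univ) →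
      (∀ s t : ℝ, a ≤ s → s < t → t ≤ T → ∀ x, u t x = heatFlow (u s) (t - s) x - oseenDuhamel 1 s u u t x) →
      (∀ s t : ℝ, a ≤ s → s < t → t ≤ T → ∀ x, v t x = heatFlow (v s) (t - s) x - oseenDuhamel 1 s v v t x) →
      0 < M → (∀ τ ∈ Icc a T, ∀ y, ‖u τ y‖ ≤ M / Real.sqrt (T₀ - τ)) →
      (∀ τ ∈ Icc a T, ∀ y, ‖v τ y‖ ≤ M / Real.sqrt (T₀ - τ)) →
      (∀ y, ‖u a y - v a y‖ ≤ η) →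
      ∀ t ∈ Icc a T, ∀ x,
        ‖u t x - v t x‖ ≤ η * (2 * (T₀ - a) / (T₀ - t)) ^ ⌈64 * C ^ 2 * M ^ 2⌉₊ := by
  obtain ⟨C, hC, hA⟩ := exists_oseenMild_sub_le_two_pow
  refine ⟨C, hC, ?_⟩
  intro u v a T T₀ M η haT hTT₀ hcu hcv hmu hmv hM huM hvM hη
  have hη0 : 0 ≤ η := (norm_nonneg _).trans (hη 0)
  have haT₀ : a < T₀ := lt_of_le_of_lt haT hTT₀
  set m : ℕ := ⌈64 * C ^ 2 * M ^ 2⌉₊ with hm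
  -- the dyadic block ends `b j = T₀ − (T₀ − a)/2^j`
  set b : ℕ → ℝ := fun j => T₀ - (T₀ - a) / 2 ^ j with hb
  have hb0 : b 0 = a := by simp [hb]
  have hb_lt : ∀ j, b j < T₀ := fun j => by
    simp only [hb]; have : 0 < (T₀ - a) / 2 ^ j := by positivity
    linarith
  have hb_ge : ∀ j, a ≤ b j := fun j => by
    simp only [hb]
    have h2 : (1:ℝ) ≤ 2 ^ j := one_le_pow₀ (by norm_num)
    have : (T₀ - a) / 2 ^ j ≤ T₀ - a := div_le_self (by linarith) h2
    linarith
  have hb_succ : ∀ j, b (j + 1) - b j = (T₀ - a) / 2 ^ (j + 1) := fun j => by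
    simp only [hb, pow_succ]; field_simp; ring
  have hb_gap : ∀ j, T₀ - b (j + 1) = (T₀ - a) / 2 ^ (j + 1) := fun j => by simp only [hb]; ring
  -- induction over blocks
  have hind : ∀ j : ℕ, ∀ t ∈ Icc a T, t ≤ b j → ∀ x, ‖u t x - v t x‖ ≤ 2 ^ (m * j) * η := by
    intro j
    induction j with
    | zero =>
      intro t ht htj x
      have hta : t = a := le_antisymm (by rw [hb0] at htj; exact htj) ht.1
      rw [hta, mul_zero, pow_zero, one_mul]
      exact hη x
    | succ j ih =>
      intro t ht htj x
      by_cases hle : t ≤ b j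
      · refine (ih t ht hle x).trans (mul_le_mul_of_nonneg_right ?_ hη0)
        exact pow_le_pow_right₀ (by norm_num) (by nlinarith)
      push Not at hle
      -- Lemma A on the block `[b j, min T (b (j+1))]` with the bound `U = M/√(T₀ − b(j+1))`
      set a' : ℝ := b j with ha'
      set b' : ℝ := min T (b (j + 1)) with hb'
      have ha'b' : a' ≤ b' := le_min (hle.le.trans ht.2) (by linarith [hb_succ j, show 0 < (T₀ - a) / 2 ^ (j+1) by positivity])
      have haa' : a ≤ a' := hb_ge j
      have hb'T : b' ≤ T := min_le_left _ _
      have htb' : t ≤ b' := le_min ht.2 htj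
      have hgap : 0 < T₀ - b (j + 1) := by linarith [hb_lt (j + 1)]
      set U : ℝ := M / Real.sqrt (T₀ - b (j + 1)) with hU
      have hUpos : 0 < U := div_pos hM (Real.sqrt_pos.2 hgap)
      have hsub : Icc a' b' ×ˢ (univ : Set (EuclideanSpace ℝ (Fin 3))) ⊆ Icc a T ×ˢ univ :=
        prod_mono (Icc_subset_Icc haa' hb'T) subset_rfl
      have hdom : ∀ τ ∈ Icc a' b', M / Real.sqrt (T₀ - τ) ≤ U := by
        intro τ hτ
        have h1 : T₀ - b (j + 1) ≤ T₀ - τ := by linarith [hτ.2, min_le_right T (b (j + 1))]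
        exact div_le_div_of_nonneg_left hM.le (Real.sqrt_pos.2 hgap) (Real.sqrt_le_sqrt h1)
      have hηj : ∀ y, ‖u a' y - v a' y‖ ≤ 2 ^ (m * j) * η := fun y =>
        ih a' ⟨haa', hle.le.trans ht.2⟩ le_rfl y
      have hres := hA ha'b' (hcu.mono hsub) (hcv.mono hsub)
        (fun s t' hs hst' ht' x' => hmu s t' (haa'.trans hs) hst' (ht'.trans hb'T) x')
        (fun s t' hs hst' ht' x' => hmv s t' (haa'.trans hs) hst' (ht'.trans hb'T) x')
        hUpos (fun τ hτ y => (huM τ ⟨haa'.trans hτ.1, hτ.2.trans hb'T⟩ y).trans (hdom τ hτ))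
        (fun τ hτ y => (hvM τ ⟨haa'.trans hτ.1, hτ.2.trans hb'T⟩ y).trans (hdom τ hτ))
        hηj t ⟨hle.le, htb'⟩ x
      -- the block costs at most `2^m`
      have hN : ⌈64 * C ^ 2 * U ^ 2 * (b' - a')⌉₊ ≤ m := by
        refine Nat.ceil_mono ?_
        have hlen : b' - a' ≤ b (j + 1) - b j := by
          simp only [hb', ha']; linarith [min_le_right T (b (j + 1))]
        have hU2 : U ^ 2 = M ^ 2 / (T₀ - b (j + 1)) := by
          rw [hU, div_pow, Real.sq_sqrt hgap.le]
        have hkey : U ^ 2 * (b (j + 1) - b j) = M ^ 2 := by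
          have hne : T₀ - a ≠ 0 := by linarith
          rw [hU2, hb_succ, hb_gap]; field_simp
        calc 64 * C ^ 2 * U ^ 2 * (b' - a') ≤ 64 * C ^ 2 * U ^ 2 * (b (j + 1) - b j) :=
              mul_le_mul_of_nonneg_left hlen (by positivity)
          _ = 64 * C ^ 2 * M ^ 2 := by rw [mul_assoc (64 * C ^ 2), hkey]
      calc ‖u t x - v t x‖ ≤ 2 ^ ⌈64 * C ^ 2 * U ^ 2 * (b' - a')⌉₊ * (2 ^ (m * j) * η) := hres
        _ ≤ 2 ^ m * (2 ^ (m * j) * η) :=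
            mul_le_mul_of_nonneg_right (pow_le_pow_right₀ (by norm_num) hN) (by positivity)
        _ = 2 ^ (m * (j + 1)) * η := by rw [← mul_assoc, ← pow_add]; ring_nf
  -- locate `t` in a dyadic block
  intro t ht x
  have hgap_t : 0 < T₀ - t := by linarith [ht.2]
  set X : ℝ := (T₀ - a) / (T₀ - t) with hX
  have hX1 : 1 ≤ X := by rw [hX, le_div_iff₀ hgap_t]; linarith [ht.1]
  obtain ⟨n, hn1, hn2⟩ := exists_nat_pow_near hX1 (show (1:ℝ) < 2 by norm_num)
  have htb : t ≤ b (n + 1) := by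
    simp only [hb]
    have : (T₀ - a) / 2 ^ (n + 1) ≤ T₀ - t := by
      rw [div_le_iff₀ (by positivity)]
      have := hn2.le
      rw [hX, div_le_iff₀ hgap_t] at this
      linarith
    linarith
  refine (hind (n + 1) t ht htb x).trans ?_
  have h2X : (2:ℝ) ^ (n + 1) ≤ 2 * X := by rw [pow_succ]; linarith
  have hXeq : 2 * X = 2 * (T₀ - a) / (T₀ - t) := by rw [hX]; ring
  calc (2:ℝ) ^ (m * (n + 1)) * η = ((2:ℝ) ^ (n + 1)) ^ m * η := by rw [← pow_mul, Nat.mul_comm]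
    _ ≤ (2 * X) ^ m * η := mul_le_mul_of_nonneg_right (pow_le_pow_left₀ (by positivity) h2X m) hη0
    _ = η * (2 * (T₀ - a) / (T₀ - t)) ^ m := by rw [hXeq, mul_comm]

/-! ## Against a Type-I ancient mild field (KNSS gauge) -/

/-- **SHADOWING A TYPE-I ANCIENT MILD FIELD (the `L^∞` half of T1's clause (iii)).**  With the universal `C` of
`exists_oseenMild_sub_step`: let `v` be a Type-I ancient mild field (`IsTypeIAncientMild M v`, KNSS gauge) and `u` any field on
`[s₀, T] × ℝ³`, `T < 0`, which is jointly continuous, Oseen-mild between every pair of times, and obeys a Type-I bound `M'/√(−t)`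
with `M' ≥ M`, `M' > 0`.  Then `‖u(t,x) − v(t,x)‖ ≤ sup‖u(s₀,·) − v(s₀,·)‖ · (2(−s₀)/(−t))^{⌈64C²M'²⌉}` on `[s₀, T]`.
READING for line `truncation_edge` (crux 24077, stub T1 `stub_farFieldTruncation`): a truncation `u` of `v` issued at `s₀ = −1` whose
datum differs from `v(−1)` by `≲ A/R` in sup norm (the ENVELOPE `HasTypeIDecay A v` bounds the discarded far field) stays within
`(A/R)·(2/ε)^{κ(M)}` of `v` down to `t = −ε` — clause (iii) with a POLYNOMIAL radius `R ≍ (A/δ)ε^{−κ(M)}`; no cut-off commutator and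
no pressure enter.  (The existence of such a `u` in the Tao frame and the `L³` clause (ii) are NOT addressed here.) [folklore] -/
theorem exists_sub_typeIAncientMild_le :
    ∃ C : ℝ, 0 < C ∧ ∀ {M M' : ℝ} {v u : ℝ → EuclideanSpace ℝ (Fin 3) → EuclideanSpace ℝ (Fin 3)} {s₀ T η : ℝ},
      IsTypeIAncientMild M v → s₀ ≤ T → T < 0 → 0 < M' → M ≤ M' →
      ContinuousOn (uncurry u) (Icc s₀ T ×ˢ univ) →
      (∀ s t : ℝ, s₀ ≤ s → s < t → t ≤ T → ∀ x, u t x = heatFlow (u s) (t - s) x - oseenDuhamel 1 s u u t x) →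
      (∀ τ ∈ Icc s₀ T, ∀ y, ‖u τ y‖ ≤ M' / Real.sqrt (-τ)) →
      (∀ y, ‖u s₀ y - v s₀ y‖ ≤ η) →
      ∀ t ∈ Icc s₀ T, ∀ x,
        ‖u t x - v t x‖ ≤ η * (2 * (-s₀) / (-t)) ^ ⌈64 * C ^ 2 * M' ^ 2⌉₊ := by
  obtain ⟨C, hC, hB⟩ := exists_oseenMild_sub_le_of_typeI
  refine ⟨C, hC, ?_⟩
  intro M M' v u s₀ T η hv hs₀T hT hM' hMM' hcu hmu huM hη
  have hslab : Icc s₀ T ×ˢ (univ : Set (EuclideanSpace ℝ (Fin 3))) ⊆ Iio 0 ×ˢ univ :=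
    prod_mono (fun τ hτ => lt_of_le_of_lt hτ.2 hT) subset_rfl
  have hcv : ContinuousOn (uncurry v) (Icc s₀ T ×ˢ univ) := hv.continuousOn_uncurry.mono hslab
  have hmv : ∀ s t : ℝ, s₀ ≤ s → s < t → t ≤ T → ∀ x,
      v t x = heatFlow (v s) (t - s) x - oseenDuhamel 1 s v v t x :=
    fun s t _ hst htT x => hv.mild_eq hst (lt_of_le_of_lt htT hT) x
  have huM' : ∀ τ ∈ Icc s₀ T, ∀ y, ‖u τ y‖ ≤ M' / Real.sqrt (0 - τ) := fun τ hτ y => by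
    rw [zero_sub]; exact huM τ hτ y
  have hvM' : ∀ τ ∈ Icc s₀ T, ∀ y, ‖v τ y‖ ≤ M' / Real.sqrt (0 - τ) := fun τ hτ y => by
    have hτ0 : τ < 0 := lt_of_le_of_lt hτ.2 hT
    rw [zero_sub]
    exact (hv.norm_le hτ0 y).trans
      (div_le_div_of_nonneg_right hMM' (Real.sqrt_nonneg _))
  intro t ht x
  have := hB hs₀T hT hcu hcv hmu hmv hM' huM' hvM' hη t ht x
  simpa only [zero_sub] using this

end Summit.NavierStokesRegularity.NavierStokesRegularity.Theorems.QuarterLogPincerTruncationEdge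

end
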